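import Summits.BirchSwinnertonDyer.BirchSwinnertonDyer.Theorems.ThetaPartnerAtTwoSignedControlAtTwoPlusLogDescentTwo
import Summits.BirchSwinnertonDyer.BirchSwinnertonDyer.Theorems.ThetaPartnerAtTwoSignedKatoUpToAtTwoLocalTwoModel
import Summits.BirchSwinnertonDyer.Rank1Residual.Additive.KobayashiLayerSaturation
import HarnessLib

/-!
# HONDA⁺@2, assembly brick (v): the ODD-INDEX DISCHARGE — the (GEN) clause of `stub_plusHondaSystemTwo` at level `n`
# for ALL points of the layer `E(ℚ_{2,n}·ℚ₂) = localLayerPointsOfEmb κ ι W n` from the (GEN) clause for the points of the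
# kernel of reduction `E₁` (K4 `SignedControlAtTwo`, stmt-BirchSwinnertonDyer-20309, line `eulerchar` v6)

Route `ThetaPartnerAtTwo` (TP2; crux shared with `ResidualThetaTransportAtTwo`), crux K4, line `eulerchar` v6 (8d2b4be25f391f24,
lead `prover-bsd-wall-tp2-p3` g2); seat `prover-bsd-wall-tp2-p3-w3` (width seat 3/3, g2 — the K4 assembler).

WHY. The generation step along the plus tower (lead's `SignedEC.PlusTower.exists_sub_closure_sub_two_smul_plus`, width seat 2's
`SignedEC.PlusLayer.exists_sub_closure_sub_two_smul_mem_plus` (D4)) produces the (GEN) clause of the v6 stub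
`stub_plusHondaSystemTwo` at level `n` for the points `P` of the KERNEL OF REDUCTION `E₁` (read on a `ℤ₂`-model `M` with
`M ⊗ ℚ̄₂ = W ⊗ ℚ̄₂`, coordinates in `ℚ₂(ζ_{2^{n+2}})`, `toLoc P ∈ E(ℚ_{2,n}·ℚ₂)`). The stub wants it for EVERY
`Q ∈ localLayerPointsOfEmb κ ι W n`. Kobayashi's passage (proof of Prop. 8.12): `E(k_n)/Ê(𝔪_n) ↪ Ẽ(𝔽₂)`, a group of ODD order
`3 = 2 + 1 − a₂` at a supersingular `2` with `a₂ = 0`, so `3Q ∈ E₁` and `Q = 3Q − 2Q`. Width seat 2 typed the last line as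
(D5) `plusGen_of_plusGen_odd_nsmul` with the odd multiple as a hypothesis; THIS FILE discharges the multiple and the Galois
descent of coordinates, in the stub's own currency.

WHAT (THEOREMS ONLY).
* §1 (generic `ℤ₂`-model `M` with elliptic special fibre, `hV : genFibΩ 2 M = W ⊗ ℚ̄₂`, cyclotomic `κ`, any `ι`)
  `toLoc_symm_mem_subfieldPoints_of_mem_localLayerPointsOfEmb_two` — a layer-`n` point, read on the model, has coordinates in
  `layer 2 (n+2) = ℚ₂(ζ_{2^{n+2}})` (Galois descent: width seat 2's `mem_localLayerPointsOfEmb_two_iff_stab` + O10's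
  `forall_smul_eq_iff_mem_subfieldPoints`); `toLoc_symm_nsmul_card_mem_kernel` (`#Ẽ(𝔽₂) • Q ∈ E₁`, O10 class-closure file 37
  `card_smul_mem_kernel_of_mem_subfieldPoints`); `toLoc_symm_three_nsmul_mem_kernel` (`3 • Q ∈ E₁` when `a₂(M) = 0`);
  **`plusGen_two_of_plusGen_kernel`** — for ANY subgroup `S ≤ E(ℚ̄₂)` (in practice `ℤ[Γ_{ℚ₂}]·d_n`): the (GEN) clause
  «`Q = B + P' + 2•R`, `B ∈ S`, `P' ∈ E(ℚ_{2,n−1}·ℚ₂)`, `R ∈ E(ℚ_{2,n}·ℚ₂)`» for every `Q ∈ E(ℚ_{2,n}·ℚ₂)` ⟸ the same for the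
  `toLoc P`, `P ∈ L(n+2) ∩ E₁` with `toLoc P ∈ E(ℚ_{2,n}·ℚ₂)`.
* §2 (`W/ℚ` globally minimal, `GoodSS W 2`, `a₂(W) = 0`, K3's model `M_W = integralModelInt W ⊗ ℤ₂` and identification
  `hV_W = (genFibΩ_eq_baseChange M_W).trans (baseChange_twoAdicModel W)` — the binders of
  `SignedKatoOffTwo.LocalTwo.plusPointsLayer_two`) **`plusGen_two_of_plusGen_kernel_twoAdicModel`** — the same with every model
  hypothesis discharged (`isElliptic_toZMod_twoAdicModel`, `tr_twoAdicModel`).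

HONEST FRAMING: THEOREMS ONLY (no definition, no named fact, no instance, no `sorry`), route-independent (no `Theses` import);
pure local bookkeeping on the tree's local points; nothing about any Selmer group; closes no item; BSD is not proved by any of
this.

References: [Kobayashi2003] S. Kobayashi, Invent. Math. 152 (2003), §8.4, proof of Prop. 8.12 (`E(k_n)/Ê(𝔪_n) ↪ Ẽ(𝔽_p)`);
[SilvermanAEC2009] VII.2 Prop. 2.1 (reduction homomorphism, kernel `E₁`); [Washington1997] §13.1.
-/

set_option autoImplicit false
-- the Theorems namespace of this sub repeats the summit name by design (D-0017 nested layout)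
set_option linter.dupNamespace false

noncomputable section

open scoped Classical

namespace Summit.BirchSwinnertonDyer.BirchSwinnertonDyer.Theorems.SignedEC.PlusLayer

open Field WeierstrassCurve Literature.NumberTheory.EllipticCurves Literature.NumberTheory.GaloisRepresentations
  Literature.NumberTheory.EllipticCurves.ZpExtension Literature.NumberTheory.EllipticCurves.Kobayashi2003
  Literature.NumberTheory.EllipticCurves.FormalGroupChart
  Summit.BirchSwinnertonDyer.Rank1Residual.Additive Summit.BirchSwinnertonDyer.Rank1Residual.Additive.PadicCyclotomicTower
  Summit.BirchSwinnertonDyer.Rank1Residual.Additive.BallEval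

/-! ## §1 Generic `ℤ₂`-model: Galois descent of coordinates, `3 • Q ∈ E₁`, the odd-index step -/

section Generic

variable {M : WeierstrassCurve ℤ_[2]} {W : WeierstrassCurve ℚ} (hV : genFibΩ 2 M = W.baseChange (AlgebraicClosure ℚ_[2]))
  {κ : ZpExtension ℚ 2} (ι : AlgebraicClosure ℚ →ₐ[ℚ] PadicAlgCl 2)

/-- **Galois descent of coordinates for the `ℤ₂`-layers**: a point of `E(ℚ_{2,n}·ℚ₂) = localLayerPointsOfEmb κ ι W n`
(cyclotomic `κ`, any `ι`), read on a model `M` through `toLoc`, has coordinates in `layer 2 (n+2) = ℚ₂(ζ_{2^{n+2}}) ⊇ ℚ_{2,n}·ℚ₂`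
(it is fixed by `Stab ζ_{2^{n+2}} ≤ Gal(ℚ̄₂/ℚ_{2,n})`). [cite: Kobayashi2003, Def. 1.1, §8.4] [cite: Washington1997, §13.1] -/
theorem toLoc_symm_mem_subfieldPoints_of_mem_localLayerPointsOfEmb_two (hκ : κ.IsCyclotomic) {n : ℕ}
    {Q : localPoints W ℚ_[2]} (hQ : Q ∈ localLayerPointsOfEmb κ ι W n) :
    (toLoc hV).symm Q ∈ subfieldPoints (genFibΩ 2 M) (layer 2 (n + 2)).toSubfield coeffs_mem_layer := by
  obtain ⟨σ₀, -, hσ₀⟩ := exists_inverter_mem_localLayerSubgroupOfEmb_two ι hκ n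
  exact (forall_smul_eq_iff_mem_subfieldPoints hV (n + 2) Q).mp
    ((mem_localLayerPointsOfEmb_two_iff_stab W ι hκ hσ₀ Q).mp hQ).1

variable [hEt : (M.map PadicInt.toZMod).IsElliptic]

/-- **`#Ẽ(𝔽₂) • Q ∈ E₁`** for every `Q ∈ E(ℚ_{2,n}·ℚ₂)` (model `M` with elliptic special fibre): the reduction of `Q` is an
`𝔽₂`-point (its coordinates lie in the totally ramified `ℚ₂(ζ_{2^{n+2}})`), killed by `#Ẽ(𝔽₂)`, and `ker(red) = E₁`.
[cite: SilvermanAEC2009, VII.2 Prop. 2.1] [cite: Kobayashi2003, §8.4 (proof of Prop. 8.12)] -/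
theorem toLoc_symm_nsmul_card_mem_kernel (hκ : κ.IsCyclotomic) {n : ℕ}
    {Q : localPoints W ℚ_[2]} (hQ : Q ∈ localLayerPointsOfEmb κ ι W n) :
    haveI := isIntegral_genFib_baseChange 2 M
    (toLoc hV).symm (Nat.card (M.map PadicInt.toZMod).toAffine.Point • Q) ∈
      kernel (Valued.v (R := PadicAlgCl 2)) (genFibΩ 2 M) := by
  rw [map_nsmul]
  exact card_smul_mem_kernel_of_mem_subfieldPoints M
    (toLoc_symm_mem_subfieldPoints_of_mem_localLayerPointsOfEmb_two hV ι hκ hQ)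

/-- **`3 • Q ∈ E₁`** for every `Q ∈ E(ℚ_{2,n}·ℚ₂)` when `a₂(M) = 0` (`#Ẽ(𝔽₂) = 2 + 1 − a₂ = 3`).
[cite: Kobayashi2003, §8.4 (proof of Prop. 8.12)] [cite: SilvermanAEC2009, VII.2 Prop. 2.1] -/
theorem toLoc_symm_three_nsmul_mem_kernel
    (htr : Literature.NumberTheory.EllipticCurves.HasseManin.tr (M.map PadicInt.toZMod) = 0)
    (hκ : κ.IsCyclotomic) {n : ℕ} {Q : localPoints W ℚ_[2]} (hQ : Q ∈ localLayerPointsOfEmb κ ι W n) :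
    haveI := isIntegral_genFib_baseChange 2 M
    (toLoc hV).symm (3 • Q) ∈ kernel (Valued.v (R := PadicAlgCl 2)) (genFibΩ 2 M) := by
  -- (kernel-membership unfolds to an implicit `∀`; keep the applications explicit)
  have h := @toLoc_symm_nsmul_card_mem_kernel M W hV κ ι hEt hκ n Q hQ
  rw [natCard_point_eq_of_tr_eq_zero (M := M) htr] at h
  exact @h

/-- **THE ODD-INDEX STEP of HONDA⁺@2 (GEN), stub currency.** `M/ℤ₂` a model of `W ⊗ ℚ̄₂` with elliptic special fibre and
`a₂(M) = 0`, `κ` cyclotomic, `ι` any, `n` any, `S ≤ E(ℚ̄₂)` ANY subgroup (in the stub: `ℤ[Γ_{ℚ₂}]·d_n`). IF every point `P` of the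
model with coordinates in `ℚ₂(ζ_{2^{n+2}})`, in the kernel of reduction, and with `toLoc P ∈ E(ℚ_{2,n}·ℚ₂)` satisfies
`toLoc P = B + P' + 2•R` (`B ∈ S`, `P' ∈ E(ℚ_{2,n−1}·ℚ₂)`, `R ∈ E(ℚ_{2,n}·ℚ₂)`), THEN so does every `Q ∈ E(ℚ_{2,n}·ℚ₂)`:
apply the hypothesis to `3Q ∈ E₁` and use `Q = 3Q − 2Q` (width seat 2's (D5) `plusGen_of_plusGen_odd_nsmul`).
[cite: Kobayashi2003, §8.4, proof of Prop. 8.12] -/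
theorem plusGen_two_of_plusGen_kernel
    (htr : Literature.NumberTheory.EllipticCurves.HasseManin.tr (M.map PadicInt.toZMod) = 0)
    (hκ : κ.IsCyclotomic) {n : ℕ} (S : AddSubgroup (localPoints W ℚ_[2]))
    (h : haveI := isIntegral_genFib_baseChange 2 M
      ∀ P ∈ subfieldPoints (genFibΩ 2 M) (layer 2 (n + 2)).toSubfield coeffs_mem_layer,
        P ∈ kernel (Valued.v (R := PadicAlgCl 2)) (genFibΩ 2 M) → toLoc hV P ∈ localLayerPointsOfEmb κ ι W n →
          ∃ B ∈ S, ∃ P' ∈ localLayerPointsOfEmb κ ι W (n - 1), ∃ R ∈ localLayerPointsOfEmb κ ι W n,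
            toLoc hV P = B + P' + 2 • R)
    {Q : localPoints W ℚ_[2]} (hQ : Q ∈ localLayerPointsOfEmb κ ι W n) :
    ∃ B ∈ S, ∃ P' ∈ localLayerPointsOfEmb κ ι W (n - 1), ∃ R ∈ localLayerPointsOfEmb κ ι W n, Q = B + P' + 2 • R := by
  refine plusGen_of_plusGen_odd_nsmul hQ (c := 3) (by decide) ?_
  have h3Q : 3 • Q ∈ localLayerPointsOfEmb κ ι W n := AddSubgroup.nsmul_mem _ hQ 3
  have hk := @toLoc_symm_three_nsmul_mem_kernel M W hV κ ι hEt htr hκ n Q hQ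
  have h3 := h ((toLoc hV).symm (3 • Q))
    (toLoc_symm_mem_subfieldPoints_of_mem_localLayerPointsOfEmb_two hV ι hκ h3Q) (@hk)
    (by rw [AddEquiv.apply_symm_apply]; exact h3Q)
  rwa [AddEquiv.apply_symm_apply] at h3

end Generic

/-! ## §2 The curve `W` itself on K3's model `M_W = integralModelInt W ⊗ ℤ₂` -/

section Curve

open Summit.BirchSwinnertonDyer.BirchSwinnertonDyer.Theorems.SignedKatoOffTwo.LocalTwo

variable (W : WeierstrassCurve ℚ) [W.IsGloballyMinimal]
  {κ : ZpExtension ℚ 2} (ι : AlgebraicClosure ℚ →ₐ[ℚ] PadicAlgCl 2)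

/-- **THE ODD-INDEX STEP for `W` itself** (`W/ℚ` globally minimal, `GoodSS W 2`, `a₂(W) = 0`; K3's model `M_W` and its
identification `hV_W`, the binders of `SignedKatoOffTwo.LocalTwo.plusPointsLayer_two`): for any `n` and any subgroup `S`, the
(GEN) clause at level `n` for every `Q ∈ E(ℚ_{2,n}·ℚ₂)` ⟸ the (GEN) clause for the `E₁`-points of `M_W` over `ℚ₂(ζ_{2^{n+2}})`
lying in `E(ℚ_{2,n}·ℚ₂)`. [cite: Kobayashi2003, §8.4, proof of Prop. 8.12] -/
theorem plusGen_two_of_plusGen_kernel_twoAdicModel (hss : Rank1Residual.GoodSS W 2) (ha : W.frobeniusTrace 2 = 0)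
    (hκ : κ.IsCyclotomic) {n : ℕ} (S : AddSubgroup (localPoints W ℚ_[2]))
    (h : haveI := isIntegral_genFib_baseChange 2 ((integralModelInt W).map (Int.castRingHom ℤ_[2]))
      ∀ P ∈ subfieldPoints (genFibΩ 2 ((integralModelInt W).map (Int.castRingHom ℤ_[2]))) (layer 2 (n + 2)).toSubfield
          coeffs_mem_layer,
        P ∈ kernel (Valued.v (R := PadicAlgCl 2)) (genFibΩ 2 ((integralModelInt W).map (Int.castRingHom ℤ_[2]))) →
        toLoc ((genFibΩ_eq_baseChange ((integralModelInt W).map (Int.castRingHom ℤ_[2]))).trans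
            (baseChange_twoAdicModel W)) P ∈ localLayerPointsOfEmb κ ι W n →
          ∃ B ∈ S, ∃ P' ∈ localLayerPointsOfEmb κ ι W (n - 1), ∃ R ∈ localLayerPointsOfEmb κ ι W n,
            toLoc ((genFibΩ_eq_baseChange ((integralModelInt W).map (Int.castRingHom ℤ_[2]))).trans
              (baseChange_twoAdicModel W)) P = B + P' + 2 • R)
    {Q : localPoints W ℚ_[2]} (hQ : Q ∈ localLayerPointsOfEmb κ ι W n) :
    ∃ B ∈ S, ∃ P' ∈ localLayerPointsOfEmb κ ι W (n - 1), ∃ R ∈ localLayerPointsOfEmb κ ι W n, Q = B + P' + 2 • R := by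
  haveI := isElliptic_toZMod_twoAdicModel W hss.1
  have htr : Literature.NumberTheory.EllipticCurves.HasseManin.tr
      (((integralModelInt W).map (Int.castRingHom ℤ_[2])).map PadicInt.toZMod) = 0 := by
    rw [tr_twoAdicModel W hss.1, ha]
  exact plusGen_two_of_plusGen_kernel _ ι htr hκ S h hQ

end Curve

end Summit.BirchSwinnertonDyer.BirchSwinnertonDyer.Theorems.SignedEC.PlusLayer

end
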